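import Summits.HubbardSuperconductivity.HubbardSuperconductivity.Theorems.AnisotropyChordTransferFibre3RateLemma
import Summits.HubbardSuperconductivity.HubbardSuperconductivity.Theorems.AnisotropyChordTransferFibre3KernelHarmonicity

/-!
# Route `AnisotropyChord` / H0 rotor rung: PartN39 v3 — the TWO-HOLE QUASI-NULL IDENTITY and the ONE-HOLE η-IDENTITY on the torus, PROVED

PORT PartN39 (`…Fibre3RateLemma`, namespace `OneHoleTorus`; theory seat `hubbard-h0-rotor-theory-1` g21, memo 21 §327(d), §332)
types, over the one-hole torus cluster `c, ±e₁, ±e₂` with kernel matrix `A = (2a(p − q))` (walk units, `a = aKer`),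
* `TwoHoleQuasiNull` — `A v = (1 + ε_c)δ_c` for `v = γδ_c + ½1_B`, and for every disjoint separation `d` the Hankel coupling
  acts as `M_d v = ε_c (1 − a(d − p)/a(e))`;
* `EtaIdentity` — `(A⁻¹1)_c = x_c` and `Pinf·1_B = η_L·1_B` with the explicit `η_L`.
This file proves both (`twoHoleQuasiNull_holds`, `etaIdentity_holds`) from the exact λ-harmonicity of the kernel
(`kernelHarmonicity_holds`, `kernelAxisValue_holds`, prover `hubbard-h0-rotor-p1` g23) and the lattice symmetries
`a(−r) = a(r)`, `a(r₂,r₁) = a(r₁,r₂)`: every row of `A v` / `M_d v` is `2a(r)γ + Σ_e a(r + e)` with `r = p` resp. `r = d − p`,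
and `Σ_e a(r+e) = 4a(r) + δ_{r0} − 1/V + λ(G̃(0) − a(r))`; for `EtaIdentity`, `A⁻¹δ_c = v/(1+ε_c)`, `A⁻¹1_B = δ_c/(2a(e₁))`
and `4a(e₁) = 1 + ε_c` (`KernelAxisValue`).
Prover seat `hubbard-h0-rotor-p2` g0; helper for stmt-HubbardSuperconductivity-19089 (`--supports`, helper class).
WHAT THIS IS NOT: nothing here proves superconductivity in the Hubbard model; helper identities of ONE conditional reduction
(rung 19089, HOLE₂(.75) far pairs, finite-`L` defect of the ℤ² skeleton).  Mathlib + tree imports only; no sorry, no axioms.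
-/

set_option linter.dupNamespace false

noncomputable section

namespace Summit.HubbardSuperconductivity.HubbardSuperconductivity.Theorems.AnisotropyChord.Transfer.Fibre3

namespace OneHoleTorus

open Real Finset Matrix

variable (L : ℕ) [NeZero L]

/-! ## Lattice symmetries of `a` on the cross -/

/-- `a(−r) = a(r)`. -/
theorem aKer_neg (lam2 : ℝ) (r : Tor L) : aKer L lam2 (-r) = aKer L lam2 r := by
  unfold aKer; rw [Gres_neg]

/-- `a(0) = 0`. -/
theorem aKer_zero (lam2 : ℝ) : aKer L lam2 0 = 0 := by
  unfold aKer; ring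

/-- the four cross points carry the same kernel value `a(e₁)`. -/
theorem aKer_pt_succ (lam2 : ℝ) (b : Fin 4) : aKer L lam2 (pt L b.succ) = aKer L lam2 ((1 : ZMod L), 0) := by
  have hswap : aKer L lam2 ((0 : ZMod L), 1) = aKer L lam2 ((1 : ZMod L), 0) := by
    unfold aKer
    have := Gres_swap L lam2 (((1 : ZMod L), (0 : ZMod L)) : Tor L)
    simp only at this
    rw [this]
  fin_cases b
  · rfl
  · show aKer L lam2 ((-1 : ZMod L), 0) = _
    rw [show (((-1 : ZMod L), (0 : ZMod L)) : Tor L) = -((1 : ZMod L), 0) by ext <;> simp, aKer_neg]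
  · exact hswap
  · show aKer L lam2 ((0 : ZMod L), -1) = _
    rw [show (((0 : ZMod L), (-1 : ZMod L)) : Tor L) = -((0 : ZMod L), 1) by ext <;> simp, aKer_neg, hswap]

omit [NeZero L] in
/-- the cross points are nonzero (`L ≥ 2`). -/
theorem pt_succ_ne_zero (hL : 2 ≤ L) (b : Fin 4) : pt L b.succ ≠ 0 := by
  have h1 : (1 : ZMod L) ≠ 0 := by
    intro h
    have := congrArg ZMod.val h
    rw [ZMod.val_one_eq_one_mod, ZMod.val_zero, Nat.mod_eq_of_lt (by omega : 1 < L)] at this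
    exact one_ne_zero this
  have hm1 : (-1 : ZMod L) ≠ 0 := neg_ne_zero.2 h1
  fin_cases b
  · show (((1 : ZMod L), (0 : ZMod L)) : Tor L) ≠ 0
    intro h; exact h1 (congrArg Prod.fst h)
  · show (((-1 : ZMod L), (0 : ZMod L)) : Tor L) ≠ 0
    intro h; exact hm1 (congrArg Prod.fst h)
  · show (((0 : ZMod L), (1 : ZMod L)) : Tor L) ≠ 0
    intro h; exact h1 (congrArg Prod.snd h)
  · show (((0 : ZMod L), (-1 : ZMod L)) : Tor L) ≠ 0
    intro h; exact hm1 (congrArg Prod.snd h)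

/-! ## The cross sum by λ-harmonicity -/

/-- `Σ_{b ∈ B} a(x − pt b) = Σ_e a(x + e) = 4a(x) + δ_{x0} − 1/V + λ(G̃(0) − a(x))`. -/
theorem cross_sum (lam2 : ℝ) (h0 : 0 ≤ lam2) (hlam : lam2 < 2 * eps1 L) (x : Tor L) :
    aKer L lam2 (x - pt L 1) + aKer L lam2 (x - pt L 2) + aKer L lam2 (x - pt L 3) + aKer L lam2 (x - pt L 4)
      = 4 * aKer L lam2 x + (if x = 0 then (1 : ℝ) else 0) - 1 / (L : ℝ) ^ 2
          + lam2 * (Gres L lam2 0 - aKer L lam2 x) := by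
  rw [← kernelHarmonicity_holds L lam2 h0 hlam x, nnList_map_sum]
  have e1 : x - pt L 1 = x + -ex L := by
    show x - (((1 : ZMod L), (0 : ZMod L)) : Tor L) = _; unfold ex; rw [sub_eq_add_neg]
  have e2 : x - pt L 2 = x + ex L := by
    show x - (((-1 : ZMod L), (0 : ZMod L)) : Tor L) = _
    unfold ex; rw [sub_eq_add_neg]; congr 1; ext <;> simp
  have e3 : x - pt L 3 = x + -ey L := by
    show x - (((0 : ZMod L), (1 : ZMod L)) : Tor L) = _; unfold ey; rw [sub_eq_add_neg]
  have e4 : x - pt L 4 = x + ey L := by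
    show x - (((0 : ZMod L), (-1 : ZMod L)) : Tor L) = _
    unfold ey; rw [sub_eq_add_neg]; congr 1; ext <;> simp
  rw [e1, e2, e3, e4]
  ring

/-- the rows of a cluster-kernel product with `v = γδ_c + ½1_B`:
`Σ_j 2a(y − pt j) v_j = 2a(y)γ + Σ_b a(y − pt b)`. -/
theorem row_eval (lam2 : ℝ) (y : Tor L) :
    (∑ j : Fin 5, 2 * aKer L lam2 (y - pt L j) * vtest L lam2 j)
      = 2 * aKer L lam2 y * gammaL L lam2
        + (aKer L lam2 (y - pt L 1) + aKer L lam2 (y - pt L 2) + aKer L lam2 (y - pt L 3) + aKer L lam2 (y - pt L 4)) := by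
  simp only [Fin.sum_univ_five, vtest]
  have h0 : pt L 0 = 0 := rfl
  simp only [h0, sub_zero, if_true, show (1 : Fin 5) ≠ 0 by decide, show (2 : Fin 5) ≠ 0 by decide,
    show (3 : Fin 5) ≠ 0 by decide, show (4 : Fin 5) ≠ 0 by decide, if_false]
  ring

/-- ★ `TwoHoleQuasiNull` holds. -/
theorem twoHoleQuasiNull_holds : TwoHoleQuasiNull L := by
  intro hL lam2 hlam0 hlam ha1
  have hL2 : 2 ≤ L := by omega
  set a1 := aKer L lam2 ((1 : ZMod L), 0) with ha1def
  have hA1 : (2 * (2 * a1)) ≠ 0 := by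
    intro h; apply ha1; linarith
  constructor
  · -- A v = (1 + ε_c) δ_c
    ext i
    have hrow : (Amat L lam2).mulVec (vtest L lam2) i
        = 2 * aKer L lam2 (pt L i) * gammaL L lam2
          + (aKer L lam2 (pt L i - pt L 1) + aKer L lam2 (pt L i - pt L 2) + aKer L lam2 (pt L i - pt L 3)
              + aKer L lam2 (pt L i - pt L 4)) := by
      simp only [Matrix.mulVec, dotProduct, Amat, Matrix.of_apply]
      exact row_eval L lam2 (pt L i)
    rw [hrow, cross_sum L lam2 hlam0.le hlam (pt L i)]
    refine Fin.cases ?_ (fun b => ?_) i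
    · -- centre row
      have h0 : pt L 0 = 0 := rfl
      simp only [h0, aKer_zero, if_true]
      unfold epsC
      ring
    · -- boundary rows
      have hb : pt L b.succ ≠ 0 := pt_succ_ne_zero L hL2 b
      rw [if_neg hb, aKer_pt_succ L lam2 b, if_neg (Fin.succ_ne_zero b)]
      unfold gammaL epsC
      rw [← ha1def]
      field_simp
      ring
  · -- M_d v = ε_c (1 − a(d − pt i)/a(e₁))
    intro d hd
    ext i
    have hrow : (Mmat L lam2 d).mulVec (vtest L lam2) i
        = 2 * aKer L lam2 (d - pt L i) * gammaL L lam2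
          + (aKer L lam2 (d - pt L i - pt L 1) + aKer L lam2 (d - pt L i - pt L 2) + aKer L lam2 (d - pt L i - pt L 3)
              + aKer L lam2 (d - pt L i - pt L 4)) := by
      simp only [Matrix.mulVec, dotProduct, Mmat, Matrix.of_apply]
      exact row_eval L lam2 (d - pt L i)
    have hr : d - pt L i ≠ 0 := by
      have := hd i 0
      have h0 : pt L 0 = 0 := rfl
      rwa [h0, sub_zero] at this
    rw [hrow, cross_sum L lam2 hlam0.le hlam (d - pt L i), if_neg hr]
    unfold gammaL epsC
    rw [← ha1def]
    field_simp
    ring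

/-! ## The η-identity -/

/-- `A δ_c = 2a(e₁)·1_B`. -/
theorem Amat_mulVec_delta (lam2 : ℝ) :
    (Amat L lam2).mulVec (fun j => if j = 0 then (1 : ℝ) else 0)
      = fun i => if i = 0 then 0 else 2 * aKer L lam2 ((1 : ZMod L), 0) := by
  ext i
  simp only [Matrix.mulVec, dotProduct, Amat, Matrix.of_apply]
  simp only [Fin.sum_univ_five, if_true, show (1 : Fin 5) ≠ 0 by decide, show (2 : Fin 5) ≠ 0 by decide,
    show (3 : Fin 5) ≠ 0 by decide, show (4 : Fin 5) ≠ 0 by decide, if_false, mul_zero, add_zero, mul_one]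
  have h0 : pt L 0 = 0 := rfl
  rw [h0, sub_zero]
  refine Fin.cases ?_ (fun b => ?_) i
  · rw [if_pos rfl, h0, aKer_zero]; ring
  · rw [if_neg (Fin.succ_ne_zero b), aKer_pt_succ]

/-- ★ `EtaIdentity` holds. -/
theorem etaIdentity_holds : EtaIdentity L := by
  intro hL lam2 hlam0 hlam hdet heps hsv
  have hL2 : 2 ≤ L := by omega
  set a1 := aKer L lam2 ((1 : ZMod L), 0) with ha1def
  set ec := epsC L lam2 with hec
  -- 4 a(e₁) = 1 + ε_c (KernelAxisValue)
  have hax : a1 = (1 + ec) / 4 := by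
    have h := kernelAxisValue_holds L lam2 hlam0.le hlam
    rw [← ha1def] at h
    rw [h, hec]; unfold epsC; ring
  have ha1 : a1 ≠ 0 := by
    rw [hax]; intro h; apply heps; linarith
  -- the two solved linear systems
  obtain ⟨hAv, -⟩ := twoHoleQuasiNull_holds L hL lam2 hlam0 hlam (by rw [← ha1def]; exact ha1)
  have hinv : ∀ w : Fin 5 → ℝ, (Amat L lam2)⁻¹.mulVec ((Amat L lam2).mulVec w) = w := by
    intro w
    rw [Matrix.mulVec_mulVec, Matrix.nonsing_inv_mul _ hdet, Matrix.one_mulVec]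
  set δ : Fin 5 → ℝ := fun j => if j = 0 then (1 : ℝ) else 0 with hδ
  set oneB : Fin 5 → ℝ := fun j => if j = 0 then (0 : ℝ) else 1 with honeB
  have hone : (fun _ : Fin 5 => (1 : ℝ)) = δ + oneB := by
    ext j; simp only [hδ, honeB, Pi.add_apply]; split_ifs <;> norm_num
  -- A⁻¹ δ_c = v/(1+ε_c)
  have hAinv_delta : (Amat L lam2)⁻¹.mulVec δ = (1 + ec)⁻¹ • vtest L lam2 := by
    have h1 : (Amat L lam2).mulVec ((1 + ec)⁻¹ • vtest L lam2) = δ := by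
      rw [Matrix.mulVec_smul, hAv]
      ext j
      simp only [hδ, Pi.smul_apply, smul_eq_mul]
      split_ifs
      · rw [← hec]; field_simp
      · ring
    rw [← h1, hinv]
  -- A⁻¹ 1_B = δ_c/(2a₁)
  have hAinv_oneB : (Amat L lam2)⁻¹.mulVec oneB = (2 * a1)⁻¹ • δ := by
    have h1 : (Amat L lam2).mulVec ((2 * a1)⁻¹ • δ) = oneB := by
      rw [Matrix.mulVec_smul, hδ, Amat_mulVec_delta, ← ha1def]
      ext j
      simp only [honeB, Pi.smul_apply, smul_eq_mul]
      split_ifs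
      · ring
      · field_simp
    rw [← h1, hinv]
  -- x = A⁻¹ 1
  have hx : xv L lam2 = (1 + ec)⁻¹ • vtest L lam2 + (2 * a1)⁻¹ • δ := by
    unfold xv
    rw [hone, Matrix.mulVec_add, hAinv_delta, hAinv_oneB]
  have hx0 : xv L lam2 0 = gammaL L lam2 / (1 + ec) + 1 / (2 * a1) := by
    rw [hx]; simp [vtest, hδ]; ring
  have hxb : ∀ b : Fin 4, xv L lam2 b.succ = 1 / (2 * (1 + ec)) := by
    intro b
    rw [hx]
    simp [vtest, hδ, Fin.succ_ne_zero]
  -- (i) the centre component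
  have hxC : xv L lam2 0 = xC L lam2 := by
    rw [hx0]
    unfold gammaL xC
    rw [← ha1def, ← hec]
    have h2a1 : 2 * a1 = (1 + ec) / 2 := by rw [hax]; ring
    field_simp
    rw [hax]
    ring
  refine ⟨hxC, ?_⟩
  -- (ii) Pinf · 1 = η 1
  have hsv_eq : sv L lam2 = xv L lam2 0 + 4 * (1 / (2 * (1 + ec))) := by
    unfold sv
    rw [Fin.sum_univ_five]
    rw [show (1 : Fin 5) = (0 : Fin 4).succ from rfl, show (2 : Fin 5) = (1 : Fin 4).succ from rfl,
      show (3 : Fin 5) = (2 : Fin 4).succ from rfl, show (4 : Fin 5) = (3 : Fin 4).succ from rfl,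
      hxb, hxb, hxb, hxb]
    ring
  -- the boundary block of A⁻¹ annihilates 1_B: Σ_{b'} (A⁻¹)_{b b'} = (A⁻¹ 1_B)_b = 0
  have hblock : ∀ b : Fin 4, ∑ j : Fin 4, (Amat L lam2)⁻¹ b.succ j.succ = 0 := by
    intro b
    have h := congrFun hAinv_oneB b.succ
    simp only [Matrix.mulVec, dotProduct, honeB, hδ, Pi.smul_apply, smul_eq_mul, Fin.succ_ne_zero, if_false,
      mul_zero] at h
    rw [Fin.sum_univ_succ] at h
    simpa [Fin.succ_ne_zero] using h
  ext i
  simp only [Pinf, Matrix.mulVec, dotProduct, Matrix.of_apply, mul_one]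
  rw [Finset.sum_sub_distrib, Finset.sum_add_distrib, Finset.sum_neg_distrib, hblock i, neg_zero, zero_add,
    ← Finset.sum_div, ← Finset.mul_sum]
  have hsum4 : ∑ j : Fin 4, xv L lam2 j.succ = 4 * (1 / (2 * (1 + ec))) := by
    rw [Fin.sum_univ_four, hxb, hxb, hxb, hxb]; ring
  rw [hsum4, hxb i, Finset.sum_ite_eq]
  simp only [Finset.mem_univ, if_true]
  unfold eta
  rw [← hec]
  have hxC' : xC L lam2 = sv L lam2 - 4 * (1 / (2 * (1 + ec))) := by
    rw [← hxC, hsv_eq]; ring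
  rw [hxC']
  field_simp
  ring

end OneHoleTorus

end Summit.HubbardSuperconductivity.HubbardSuperconductivity.Theorems.AnisotropyChord.Transfer.Fibre3

end
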